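import Summits.QuantumFields.YangMills.Theorems.SwapVirialDeficitSectorLaplaceTipDetModRot
import Summits.QuantumFields.YangMills.Theorems.SwapVirialDeficitGnomonicTaylorChordLine
import HarnessLib

/-!
# Route `SwapVirialDeficit` (YangMills): THE TIP NEAR-POINT FOLLOWER DETERMINANT MODULO THE ROTATION, p-UNIFORM FORM — leaders matched in GROUP distance (K7g), followers absolutely
# (cell ym-idea-1, skeleton ➎, `stub_core_tip`, hCore (iii)′: w3 g68's request 01:25Z — the absolute flat-near hypothesis of ✓`abs_log_det_tip_mod_rot` fails for large `|p|`
# because the stiff floors control COMPRESSED sizes; the END's three-step ✓`sqrt_det_inv_slabHub_le_ref_group` transposed;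
# free-hands support of ⟨stmt-QuantumFields-24197⟩ `SwapVirialDeficit.SwapGluedStiffness`)

★★★ `abs_log_det_tip_mod_rot_group` — tip family `A_t` (hub `angUnit θ_t`, `0 ≤ sin θ_t`, angle window `122689728·|θ_t|·L⁴ ≤ μ_F∕(8·3|Fol L|)`), apex family `A₀`
(hub `1`: fibre, ray, ambient identities), unit `u`, a LEADER point `ζ_L` (`ζ_L.2.2 = 0`) whose leader tuple at the apex hub is within GROUP distance `D` of that of
`gnoBase p′` (`0 < D ≤ 1`, `3219264·L⁴·D ≤ μ_F∕(4·3|Fol L|)`), followers `y′` with `44712000·L⁴·‖y′‖ ≤ μ_F∕(8·3|Fol L|)`: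
`|log det A_t(gnoRot u (ζ_L + ι y′)) − log det A₀(gnoBase p′)| ≤ 3`
(chain: leaders in group distance ✓`abs_log_det_gnoFolHessian_sub_le_leaders` with base coercivity ✓`gnoFolHessian_coercive_base` and the form law
✓`abs_gnoFolHessianForm_sub_le_leaders` for the coercivity at `ζ_L`; followers absolutely ✓`abs_log_det_gnoFolHessian_sub_le` ∕ ✓`gnoFolHessian_coercive_near`; the EXACT apex
symmetry ✓`det_gnoFolHessian_apex_rot`; the angle step ✓`abs_log_det_gnoFolHessian_sub_le_joint` at the rotated point with coercivity transported by ✓`gnoFolHessian_apex_coercive_rot`).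
The hypothesis `hD` is p-UNIFORM off the corner (g68's `tipRot_leaders_compressed`: after the rotation the leader displacement is `(y₀ρ⃗, x₀ρ⃗)`-type, compressed by `1+|x|²`).

HONEST LABEL: composition of landed bricks; hCore's letters, Jacobian, tails, corner and assembly, `stub_core_tip`, ⟨24197⟩ ∕ ⟨24194⟩ remain OPEN; own crux ⟨22884⟩
`LargeFieldMassRefinementTail` OPEN (blocked-on ⟨19935⟩); the Yang–Mills mass gap is NOT proved; no summit is proved by a line.  THEOREMS ONLY (0 `def`, 0 `sorry`, no instance),
standard axioms.  Width seat ym-line-sfw-p2-w2 g61 (cell ym-idea-1, free hands), `--supports stmt-QuantumFields-24197`.  References: [cite: Luscher1983, §2]; [cite: Breitung1994, Lemma 26]; [folklore].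
-/

set_option autoImplicit false
set_option synthInstance.maxSize 1024

noncomputable section

open MeasureTheory Quaternion Set Module
open scoped Quaternion BigOperators ENNReal InnerProductSpace ContDiff
open Literature.MathematicalPhysics.QuantumLattice
open Literature.MathematicalPhysics.QuantumFieldTheory hiding SU2

namespace Summit.QuantumFields.YangMills.Theorems.SwapVirialDeficit.SectorLaplace

open Summit.QuantumFields.YangMills.Theorems.FemtoTransferGap
open Summit.QuantumFields.YangMills.Theorems.FemtoTransferGap.TT
open Summit.QuantumFields.YangMills.Theorems.VirialFluxGap.RingDeficit
open Summit.QuantumFields.YangMills.Theorems.SwapVirialDeficit.SwapRing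
open Summit.QuantumFields.YangMills.Theorems.SwapVirialDeficit.BlowUpRing

variable {L : ℕ} [NeZero L]

set_option maxHeartbeats 1600000 in
/-- ★★★ **THE TIP NEAR-POINT FOLLOWER DETERMINANT MODULO THE ROTATION, LEADERS IN GROUP DISTANCE** (see the file header). [cite: Breitung1994, Lemma 26] [cite: Luscher1983, §2] -/
theorem abs_log_det_tip_mod_rot_group {ε : GnoSign L} (hε : GoodSign ε) {θt : ℝ} (hθt : 0 ≤ Real.sin θt)
    {At : GnoCoord L → GnoFol L →ₗ[ℝ] GnoFol L} (hAts : ∀ η, (At η).IsSymmetric)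
    (hAtamb : ∀ η (y : GnoFol L), ⟪At η y, y⟫_ℝ = iteratedFDeriv ℝ 2 (gnoDeficit z₀ (fun _ => 1) (angUnit θt) ε) η (fun _ => gnoFolEmb y))
    {A0 : GnoCoord L → GnoFol L →ₗ[ℝ] GnoFol L} (hA0s : ∀ η, (A0 η).IsSymmetric)
    (hA0yy : ∀ η (y : GnoFol L), ⟪A0 η y, y⟫_ℝ = iteratedFDeriv ℝ 2 (fun y' : GnoFol L => gnoDeficit z₀ (fun _ => 1) ((1 : ℝ) : ℍ) ε (η + gnoFolEmb y')) 0 (fun _ => y))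
    (hA0ray : ∀ η (y : GnoFol L), ⟪A0 η y, y⟫_ℝ = iteratedDeriv 2 (fun s : ℝ => gnoDeficit (fun _ => false) (fun _ => 1) ((1 : ℝ) : ℍ) ε (η + s • gnoFolEmb y)) 0)
    (hA0amb : ∀ η (y : GnoFol L), ⟪A0 η y, y⟫_ℝ = iteratedFDeriv ℝ 2 (gnoDeficit z₀ (fun _ => 1) ((1 : ℝ) : ℍ) ε) η (fun _ => gnoFolEmb y))
    (hwinθ : 122689728 * |θt| * (L : ℝ) ^ 4 ≤ (2304 * (L : ℝ) ^ 6 * (Fintype.card (Fol L) : ℝ))⁻¹ / (8 * (3 * (Fintype.card (Fol L) : ℝ))))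
    {u : ℍ} (hu : ‖u‖ = 1) (ζL : GnoCoord L) (hζL : ζL.2.2 = 0) (p' : ℝ × ℝ) {D : ℝ} (hD0 : 0 < D) (hD1 : D ≤ 1)
    (hD : ∀ μ, ‖su2Quat ((blowUpPoint (L := L) 1 (gnomonicPoint ((1 : ℝ) : ℍ) ε (gnoBase p'.1 p'.2))).1 μ) -
      su2Quat ((blowUpPoint (L := L) 1 (gnomonicPoint ((1 : ℝ) : ℍ) ε ζL)).1 μ)‖ ≤ D)
    (hDwin : 3219264 * (L : ℝ) ^ 4 * D ≤ (2304 * (L : ℝ) ^ 6 * (Fintype.card (Fol L) : ℝ))⁻¹ / (4 * (3 * (Fintype.card (Fol L) : ℝ))))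
    (ys : GnoFol L) (hys : 44712000 * (L : ℝ) ^ 4 * ‖ys‖ ≤ (2304 * (L : ℝ) ^ 6 * (Fintype.card (Fol L) : ℝ))⁻¹ / (8 * (3 * (Fintype.card (Fol L) : ℝ)))) :
    |Real.log (LinearMap.det (At (gnoRot u (ζL + gnoFolEmb ys)))) - Real.log (LinearMap.det (A0 (gnoBase p'.1 p'.2)))| ≤ 3 := by
  have hL : (0 : ℝ) < (L : ℝ) := Nat.cast_pos.2 (Nat.pos_of_ne_zero (NeZero.ne L))
  set μ : ℝ := (2304 * (L : ℝ) ^ 6 * (Fintype.card (Fol L) : ℝ))⁻¹ with hμ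
  have hμ0 : 0 < μ := (folMu_pos_le (L := L)).1
  set N : ℝ := (Fintype.card (Fol L) : ℝ) with hN
  have hN3 : (3 : ℝ) ≤ N := by
    have h := nine_le_finrank_gnoFol (L := L)
    rw [finrank_gnoFol_real] at h
    linarith
  have hN1 : 1 ≤ 3 * N := by linarith
  have hcentral : ∀ (x : Site 3 L) (k : SU2), k * (fun _ : Site 3 L => (1 : SU2)) x = (fun _ : Site 3 L => (1 : SU2)) x * k := fun x k => by simp
  have h1ne : ((1 : ℝ) : ℍ) ≠ 0 := by exact_mod_cast one_ne_zero
  -- windows in the forms the bricks want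
  have hDμ4 : 3219264 * (L : ℝ) ^ 4 * D ≤ μ / 4 := hDwin.trans (by rw [div_le_div_iff₀ (by positivity) (by norm_num)]; nlinarith)
  have hysμ8 : 44712000 * (L : ℝ) ^ 4 * ‖ys‖ ≤ μ / 8 := hys.trans (by rw [div_le_div_iff₀ (by positivity) (by norm_num)]; nlinarith)
  have hθμ8 : 122689728 * |θt| * (L : ℝ) ^ 4 ≤ μ / 8 := hwinθ.trans (by rw [div_le_div_iff₀ (by positivity) (by norm_num)]; nlinarith)
  -- (S1) leaders in group distance at the apex: `ζL` against `gnoBase p′`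
  have hbase : ∀ y : GnoFol L, μ * ‖y‖ ^ 2 ≤ ⟪A0 (gnoBase p'.1 p'.2) y, y⟫_ℝ := gnoFolHessian_coercive_base h1ne ε hε.1 hε.2 p'.1 p'.2 hA0ray
  have hF0 : ζL.2.2 = (gnoBase p'.1 p'.2 : GnoCoord L).2.2 := by rw [hζL]; rfl
  have hlog1 := abs_log_det_gnoFolHessian_sub_le_leaders z₀ (fun _ => (1 : SU2)) ε hε.2 hF0 hA0s hA0s hA0yy hA0yy hD0 hD1 hD hμ0 hbase
    (hDμ4.trans (by linarith))
  have hS1 : |Real.log (LinearMap.det (A0 ζL)) - Real.log (LinearMap.det (A0 (gnoBase p'.1 p'.2)))| ≤ 1 := by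
    refine hlog1.trans ?_
    rw [div_le_one hμ0]
    calc 2 * (3 * N) * (3219264 * (L : ℝ) ^ 4 * D) ≤ 2 * (3 * N) * (μ / (4 * (3 * N))) := by gcongr
      _ = μ / 2 := by field_simp; ring
      _ ≤ μ := by linarith
  -- coercivity of `A₀` at `ζL` (form law in group distance)
  have hζL : ∀ y : GnoFol L, μ / 2 * ‖y‖ ^ 2 ≤ ⟪A0 ζL y, y⟫_ℝ := fun y => by
    have h := abs_gnoFolHessianForm_sub_le_leaders z₀ (fun _ => (1 : SU2)) ε hε.2 hF0 hA0yy hA0yy hD0 hD1 hD y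
    have h1 := hbase y
    have h2 := (abs_le.1 h).1
    have h3 : 3219264 * (L : ℝ) ^ 4 * D * ‖y‖ ^ 2 ≤ μ / 4 * ‖y‖ ^ 2 := mul_le_mul_of_nonneg_right hDμ4 (sq_nonneg _)
    nlinarith
  -- (S2) followers absolutely: `ζL + ι ys` against `ζL`
  have hnear2 : 44712000 * (L : ℝ) ^ 4 * ‖(ζL + gnoFolEmb ys) - ζL‖ ≤ (μ / 2) / 2 := by
    rw [add_sub_cancel_left]
    refine le_trans (mul_le_mul_of_nonneg_left (norm_gnoFolEmb_le ys) (by positivity)) (hysμ8.trans (by linarith))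
  have hlog2 := abs_log_det_gnoFolHessian_sub_le z₀ (fun _ => (1 : SU2)) h1ne ε hA0s hA0amb (by positivity : 0 < μ / 2) hζL hnear2
  have hS2 : |Real.log (LinearMap.det (A0 (ζL + gnoFolEmb ys))) - Real.log (LinearMap.det (A0 ζL))| ≤ 1 := by
    refine hlog2.trans ?_
    rw [add_sub_cancel_left, div_le_one (by positivity)]
    have h1 : 44712000 * (L : ℝ) ^ 4 * ‖(gnoFolEmb ys : GnoCoord L)‖ ≤ μ / 8 :=
      le_trans (mul_le_mul_of_nonneg_left (norm_gnoFolEmb_le ys) (by positivity)) hysμ8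
    calc 2 * (3 * N) * (44712000 * (L : ℝ) ^ 4 * ‖(gnoFolEmb ys : GnoCoord L)‖) ≤ 2 * (3 * N) * (μ / (8 * (3 * N))) := by
          refine mul_le_mul_of_nonneg_left ?_ (by positivity)
          exact le_trans (mul_le_mul_of_nonneg_left (norm_gnoFolEmb_le ys) (by positivity)) hys
      _ = μ / 4 := by field_simp; ring
      _ ≤ μ / 2 := by linarith
  -- coercivity of `A₀` at `ζ = ζL + ι ys`, then at `gnoRot u ζ`
  have hζ : ∀ y : GnoFol L, μ / 4 * ‖y‖ ^ 2 ≤ ⟪A0 (ζL + gnoFolEmb ys) y, y⟫_ℝ := fun y => by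
    have h := gnoFolHessian_coercive_near z₀ (fun _ => (1 : SU2)) h1ne ε hA0amb hζL (ζL + gnoFolEmb ys) y
    rw [add_sub_cancel_left] at h
    have h1 : 44712000 * (L : ℝ) ^ 4 * ‖(gnoFolEmb ys : GnoCoord L)‖ ≤ μ / 8 :=
      le_trans (mul_le_mul_of_nonneg_left (norm_gnoFolEmb_le ys) (by positivity)) hysμ8
    nlinarith [sq_nonneg ‖y‖]
  have hη : ∀ y : GnoFol L, μ / 4 * ‖y‖ ^ 2 ≤ ⟪A0 (gnoRot u (ζL + gnoFolEmb ys)) y, y⟫_ℝ := gnoFolHessian_apex_coercive_rot z₀ hcentral ε hA0yy hu hζ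
  -- (S3) the exact apex symmetry
  have hS3 : LinearMap.det (A0 (gnoRot u (ζL + gnoFolEmb ys))) = LinearMap.det (A0 (ζL + gnoFolEmb ys)) := det_gnoFolHessian_apex_rot z₀ hcentral ε hA0s hA0yy hu _
  -- (S4) the angle step at `η = gnoRot u ζ`
  have hA0ambθ : ∀ η (y : GnoFol L), ⟪A0 η y, y⟫_ℝ = iteratedFDeriv ℝ 2 (gnoDeficit z₀ (fun _ => 1) (angUnit 0) ε) η (fun _ => gnoFolEmb y) := fun η y => by
    rw [angUnit_zero]; exact hA0amb η y
  have hsin0 : 0 ≤ Real.sin 0 := by rw [Real.sin_zero]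
  have hnear4 : (122689728 * |θt - 0| + 44712000 * ‖gnoRot u (ζL + gnoFolEmb ys) - gnoRot u (ζL + gnoFolEmb ys)‖) * (L : ℝ) ^ 4 ≤ (μ / 4) / 2 := by
    rw [sub_zero, sub_self, norm_zero, mul_zero, add_zero]
    exact hθμ8.trans (by linarith)
  have hlog4 := abs_log_det_gnoFolHessian_sub_le_joint z₀ (fun _ => (1 : SU2)) hθt hsin0 ε hAts hA0s hAtamb hA0ambθ (by positivity : 0 < μ / 4) hη hnear4
  rw [sub_zero, sub_self, norm_zero, mul_zero, add_zero] at hlog4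
  have hS4 : |Real.log (LinearMap.det (At (gnoRot u (ζL + gnoFolEmb ys)))) - Real.log (LinearMap.det (A0 (gnoRot u (ζL + gnoFolEmb ys))))| ≤ 1 := by
    refine hlog4.trans ?_
    rw [div_le_one (by positivity)]
    calc 2 * (3 * N) * (122689728 * |θt| * (L : ℝ) ^ 4) ≤ 2 * (3 * N) * (μ / (8 * (3 * N))) := by gcongr
      _ = μ / 4 := by field_simp; ring
  -- assemble
  rw [hS3] at hS4
  have htri : |Real.log (LinearMap.det (At (gnoRot u (ζL + gnoFolEmb ys)))) - Real.log (LinearMap.det (A0 (gnoBase p'.1 p'.2)))| ≤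
      |Real.log (LinearMap.det (At (gnoRot u (ζL + gnoFolEmb ys)))) - Real.log (LinearMap.det (A0 (ζL + gnoFolEmb ys)))| +
        (|Real.log (LinearMap.det (A0 (ζL + gnoFolEmb ys))) - Real.log (LinearMap.det (A0 ζL))| +
          |Real.log (LinearMap.det (A0 ζL)) - Real.log (LinearMap.det (A0 (gnoBase p'.1 p'.2)))|) :=
    (abs_sub_le _ _ _).trans (add_le_add le_rfl (abs_sub_le _ _ _))
  linarith

end Summit.QuantumFields.YangMills.Theorems.SwapVirialDeficit.SectorLaplace

end
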